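import Summits.Schanuel.Schanuel.Theorems.DiophantineDichotomyApproximationPropertyCycleAPIOne
import Literature.NumberTheory.Transcendental.SixExponentialsSeveralVariablesAuxiliary
import Literature.NumberTheory.Transcendental.NesterenkoUResultantHeight
import Literature.RingTheory.MvPolynomial.LeadingExponents
import Mathlib.Algebra.Order.Antidiag.FinsuppEquiv
import Mathlib.Data.Finsupp.MonomialOrder
import Mathlib.Analysis.Complex.ExponentialBounds
import HarnessLib

/-!
# The box principle modulo a homogeneous ideal, in any number of variables (helper for `CycleAPIAt 3`)

Crux `Summit.Schanuel.Schanuel.Theses.DiophantineDichotomy.ApproximationProperty`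
(stmt-Schanuel-6117), line `orbit-interpolation-determinant`, stub `CycleAPIAt3 : CycleAPIAt 3`.
The third (and second) hypersurface section of the descent in `ℙ³` needs a form `R` of degree `b`
OUTSIDE a given homogeneous ideal `I ⊂ ℚ[x₀, …, x_m]` (the selected prime curve, resp. the
selected prime surface), with integer coefficients of modulus `≤ N` and SMALL at the point
`ω̄ = (1, ω)`, the smallness being governed by the Hilbert function `H(I; b) = dim ℚ[x]_b − dim I_b`
(the number of free parameters). This file proves exactly that, for every `m` and every
homogeneous ideal (`boxPrinciple_modIdeal`): if `H(I; b) ≥ M ≥ 4` then some `R ∉ I`, homogeneous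
of degree `b`, with `1 ≤ |R| ≤ N`, `h(R) ≤ log N`, has
`|R(1, ω)| ≤ exp(c (b + 1) − ((M − 4)/2) log(N + 1))`, `c = 3 + m + log max(1, ‖ω‖)`.
The case `I = 0` (`boxPrinciple`) is Dirichlet's box principle for forms in `m + 1` variables
(`M = binom(b + m, m)`), generalising the landed ternary stub `stub_ternaryBox`; the case
`I = (Q)` recovers the mechanism of the landed `stub_boxModCurve`.

Proof: Macaulay's standard monomials. The set `B` of exponents of degree `b` that are NOT leading
exponents (lexicographic order) of members of `I` has `#B = H(I; b)`
(`Literature.RingTheory.MvPolynomial.finrank_idealDegree_eq_card`), and a non-zero polynomial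
supported on `B` never lies in `I`. Dirichlet's box principle for the single complex linear form
`p ↦ ∑_{β ∈ B} p_β ω̄^β` (`Waldschmidt1981.box_principle_complex`, `|ω̄^β| ≤ max(1,‖ω‖)^b`,
`k = (N+1)^{⌊(#B−1)/2⌋}`, `k² < (N+1)^{#B}`) gives integers `p_β`, not all zero, `|p_β| ≤ N`, with
`|∑ p_β ω̄^β| ≤ 2(2 #B max(1,‖ω‖)^b N + 1)/k ≤ 6 #B max(1,‖ω‖)^b (N+1)^{1 − ⌊(#B−1)/2⌋}` and
`⌊(#B−1)/2⌋ − 1 ≥ (M − 4)/2`, `#B ≤ 2^{b+m}`.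

Proofs only: no definitions, no named facts. Sources: Nesterenko–Philippon (eds.), LNM 1752
(2001), Ch. 3 §4 (Def. 4.1, 4.2); M. Waldschmidt, Invent. Math. 63 (1981) §3 (box principle);
Cox–Little–O'Shea, *Ideals, Varieties, and Algorithms*, Ch. 5 §3 / Ch. 9 §3 (standard monomials).
-/

set_option linter.dupNamespace false

noncomputable section

namespace Summit.Schanuel.Schanuel.Cruxes.ApproximationProperty.OrbitInterpolationDeterminant

open Literature.NumberTheory.Transcendental.Nesterenko MvPolynomial Module
open scoped BigOperators

namespace BoxModIdeal

open Literature.RingTheory.MvPolynomial (idealDegree leadingExponents mem_leadingExponents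
  finrank_idealDegree_eq_card mem_finsuppAntidiag_univ_iff)

/-! ## Standard monomials of a homogeneous ideal -/

/-- **A monomial basis of `ℚ[x]_b / I_b`.** For a homogeneous ideal `I ⊂ ℚ[x₀, …, x_m]` there is a
set `B` of exponents of degree `b` with `#B + dim I_b = dim ℚ[x]_b` such that no non-zero
polynomial supported on `B` lies in `I`: the standard monomials for the lexicographic order
(Macaulay), and `#B ≤ 2^{b+m}`. [folklore] -/
theorem exists_standard_monomials {m : ℕ} {I : Ideal (Rx m)}
    (hI : ∀ f ∈ I, ∀ d : ℕ, homogeneousComponent d f ∈ I) (b : ℕ) :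
    ∃ B : Finset (Fin (m + 1) →₀ ℕ), (∀ e ∈ B, e.degree = b) ∧
      B.card + finrank ℚ ↥(homogeneousSubmodule (Fin (m + 1)) ℚ b ⊓ I.restrictScalars ℚ) =
        finrank ℚ ↥(homogeneousSubmodule (Fin (m + 1)) ℚ b) ∧
      B.card ≤ 2 ^ (b + m) ∧
      ∀ R : Rx m, R.support ⊆ B → R ∈ I → R = 0 := by
  classical
  refine ⟨((Finset.univ : Finset (Fin (m + 1))).finsuppAntidiag b).filter
      fun e => e ∉ leadingExponents MonomialOrder.lex I, ?_, ?_, ?_, ?_⟩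
  · intro e he
    exact mem_finsuppAntidiag_univ_iff.mp (Finset.mem_filter.mp he).1
  · have h1 := finrank_idealDegree_eq_card MonomialOrder.lex I hI b
    have h2 := Finset.card_filter_add_card_filter_not
      (s := (Finset.univ : Finset (Fin (m + 1))).finsuppAntidiag b)
      (fun e => e ∈ leadingExponents MonomialOrder.lex I)
    have h3 : ((Finset.univ : Finset (Fin (m + 1))).finsuppAntidiag b).card =
        finrank ℚ ↥(homogeneousSubmodule (Fin (m + 1)) ℚ b) := by
      rw [Finset.card_finsuppAntidiag_nat_eq_choose, Finset.card_univ, Fintype.card_fin,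
        Literature.RingTheory.HilbertSamuel.finrank_homogeneousSubmodule_fin,
        show m + 1 + b - 1 = b + (m + 1) - 1 by omega]
    have h4 : finrank ℚ ↥(homogeneousSubmodule (Fin (m + 1)) ℚ b ⊓ I.restrictScalars ℚ) =
        finrank ℚ ↥(idealDegree I b) := by
      rw [idealDegree, inf_comm]
    omega
  · calc _ ≤ ((Finset.univ : Finset (Fin (m + 1))).finsuppAntidiag b).card :=
          Finset.card_filter_le _ _
      _ = (m + 1 + b - 1).choose b := by
          rw [Finset.card_finsuppAntidiag_nat_eq_choose, Finset.card_univ, Fintype.card_fin]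
      _ ≤ 2 ^ (m + 1 + b - 1) := Nat.choose_le_two_pow _ _
      _ = 2 ^ (b + m) := by rw [show m + 1 + b - 1 = b + m by omega]
  · intro R hRB hRI
    by_contra hR0
    have hmem := hRB (MonomialOrder.degree_mem_support (m := MonomialOrder.lex) hR0)
    rw [Finset.mem_filter] at hmem
    exact hmem.2 ((mem_leadingExponents _).mpr ⟨R, hRI, hR0, rfl⟩)

/-! ## Arithmetic -/

/-- `log (2^n) ≤ n`. [folklore] -/
theorem log_two_pow_le (n : ℕ) : Real.log ((2 : ℝ) ^ n) ≤ n := by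
  rw [Real.log_pow]
  have h : Real.log 2 ≤ 1 := by
    have := Real.add_one_le_exp (1 : ℝ)
    calc Real.log 2 ≤ Real.log (Real.exp 1) := Real.log_le_log (by norm_num) (by linarith)
      _ = 1 := Real.log_exp 1
  calc (n : ℝ) * Real.log 2 ≤ n * 1 := by gcongr
    _ = n := mul_one _

/-- **The final estimate.** With `A₀ ≥ 1`, `N ≥ 1`, `4 ≤ M ≤ #B ≤ 2^{b+m}`, `E = ⌊(#B−1)/2⌋`,
`k = (N+1)^E`: a quantity `V ≤ 2(2 #B A₀^b N + 1)/k` satisfies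
`V ≤ exp((3 + m + log A₀)(b+1) − ((M−4)/2) log(N+1))`. [folklore] -/
theorem final_bound {A₀ V : ℝ} {m b N M card E k : ℕ} (hA₀ : 1 ≤ A₀) (hN : 1 ≤ N) (hM : 4 ≤ M)
    (hMc : M ≤ card) (hcard : card ≤ 2 ^ (b + m)) (hE : E = (card - 1) / 2)
    (hk : k = (N + 1) ^ E)
    (hV : V ≤ 2 * ((2 * (card : ℕ) * A₀ ^ b * N + 1) / k)) :
    V ≤ Real.exp ((3 + m + Real.log A₀) * (b + 1) - ((M : ℝ) - 4) / 2 * Real.log ((N : ℝ) + 1)) := by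
  have hA : 1 ≤ A₀ ^ b := one_le_pow₀ hA₀
  have hN' : (1 : ℝ) ≤ N := by exact_mod_cast hN
  have hc4 : (4 : ℝ) ≤ card := by exact_mod_cast hM.trans hMc
  have hk0 : (0 : ℝ) < k := by rw [hk]; positivity
  have hkR : (k : ℝ) = ((N : ℝ) + 1) ^ E := by rw [hk]; push_cast; ring
  -- `E ≥ (M - 2)/2`
  have hE' : ((M : ℝ) - 2) / 2 ≤ E := by
    have h1 : 2 * E + (card - 1) % 2 = card - 1 := by rw [hE]; exact Nat.div_add_mod (card - 1) 2
    have h2 : (card - 1) % 2 < 2 := Nat.mod_lt _ (by norm_num)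
    have h3 : card - 2 ≤ 2 * E := by omega
    have h4 : ((card : ℕ) : ℝ) - 2 ≤ 2 * (E : ℝ) := by
      have : ((card - 2 : ℕ) : ℝ) = (card : ℝ) - 2 := by
        rw [Nat.cast_sub (by omega)]; norm_num
      rw [← this]; exact_mod_cast h3
    have h5 : (M : ℝ) ≤ card := by exact_mod_cast hMc
    linarith
  -- step 1: `V ≤ 6 #B A₀^b (N+1) / k`
  have h1 : V ≤ 6 * card * A₀ ^ b * (((N : ℝ) + 1) / k) := by
    have hX : (1 : ℝ) ≤ card * A₀ ^ b * N :=
      one_le_mul_of_one_le_of_one_le (one_le_mul_of_one_le_of_one_le (by linarith) hA) hN'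
    have h11 : 2 * (card : ℝ) * A₀ ^ b * N + 1 ≤ 3 * card * A₀ ^ b * ((N : ℝ) + 1) := by
      have h12 : 3 * ((card : ℝ) * A₀ ^ b * N) ≤ 3 * (card * A₀ ^ b * ((N : ℝ) + 1)) := by
        gcongr; linarith
      linarith
    calc V ≤ 2 * ((2 * (card : ℝ) * A₀ ^ b * N + 1) / k) := hV
      _ ≤ 2 * ((3 * card * A₀ ^ b * ((N : ℝ) + 1)) / k) := by gcongr
      _ = 6 * card * A₀ ^ b * (((N : ℝ) + 1) / k) := by ring
  -- step 2: `(N+1)/k ≤ exp(−((M−4)/2) log(N+1))`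
  have hlogN : 0 ≤ Real.log ((N : ℝ) + 1) := Real.log_nonneg (by linarith)
  have h2 : ((N : ℝ) + 1) / k ≤ Real.exp (-(((M : ℝ) - 4) / 2) * Real.log ((N : ℝ) + 1)) := by
    have hN1 : (0 : ℝ) < (N : ℝ) + 1 := by linarith
    have e1 : ((N : ℝ) + 1) / k = Real.exp ((1 - (E : ℝ)) * Real.log ((N : ℝ) + 1)) := by
      rw [sub_mul, one_mul, Real.exp_sub, Real.exp_log hN1, hkR, ← Real.log_pow,
        Real.exp_log (by positivity)]
    rw [e1]
    refine Real.exp_le_exp.mpr (mul_le_mul_of_nonneg_right ?_ hlogN)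
    linarith
  -- step 3: `6 #B A₀^b ≤ exp((3 + m + log A₀)(b+1))`
  have h3 : 6 * (card : ℝ) * A₀ ^ b ≤ Real.exp ((3 + m + Real.log A₀) * (b + 1)) := by
    have hlogA : 0 ≤ Real.log A₀ := Real.log_nonneg hA₀
    have hcpos : (0 : ℝ) < card := by linarith
    have e : 6 * (card : ℝ) * A₀ ^ b =
        Real.exp (Real.log 6 + Real.log card + b * Real.log A₀) := by
      rw [Real.exp_add, Real.exp_add, Real.exp_log (by norm_num), Real.exp_log hcpos,
        ← Real.log_pow, Real.exp_log (by positivity)]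
    rw [e]
    refine Real.exp_le_exp.mpr ?_
    have hlc : Real.log card ≤ b + m := by
      calc Real.log card ≤ Real.log ((2 : ℝ) ^ (b + m)) :=
            Real.log_le_log hcpos (by exact_mod_cast hcard)
        _ ≤ (b + m : ℕ) := log_two_pow_le _
        _ = b + m := by push_cast; ring
    have hb : (0 : ℝ) ≤ b := Nat.cast_nonneg b
    have hm : (0 : ℝ) ≤ m := Nat.cast_nonneg m
    have hexp : (3 + (m : ℝ) + Real.log A₀) * (b + 1) =
        3 * b + 3 + m * b + m + b * Real.log A₀ + Real.log A₀ := by ring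
    rw [hexp]
    have hlog6 : Real.log 6 ≤ 2 := by
      have h6 : (6 : ℝ) ≤ Real.exp 2 := by
        have he : (2.7182818283 : ℝ) < Real.exp 1 := Real.exp_one_gt_d9
        have h2 : Real.exp 2 = Real.exp 1 * Real.exp 1 := by rw [← Real.exp_add]; norm_num
        nlinarith [Real.exp_pos 1]
      calc Real.log 6 ≤ Real.log (Real.exp 2) := Real.log_le_log (by norm_num) h6
        _ = 2 := Real.log_exp 2
    have hmb : 0 ≤ (m : ℝ) * b := mul_nonneg hm hb
    linarith
  -- assembly
  calc V ≤ 6 * card * A₀ ^ b * (((N : ℝ) + 1) / k) := h1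
    _ ≤ Real.exp ((3 + m + Real.log A₀) * (b + 1)) *
          Real.exp (-(((M : ℝ) - 4) / 2) * Real.log ((N : ℝ) + 1)) :=
        mul_le_mul h3 h2 (by positivity) (by positivity)
    _ = _ := by rw [← Real.exp_add]; ring_nf

end BoxModIdeal

/-- **The box principle modulo a homogeneous ideal** (any number of variables). For `ω ∈ ℂᵐ`
there is `c = c(ω, m) > 0` (namely `3 + m + log max(1, ‖ω‖)`) such that for every homogeneous
ideal `I ⊂ ℚ[x₀, …, x_m]` (homogeneity in the explicit form: `I` contains the homogeneous components
of its members, e.g. `MvPolynomial.homogeneousComponent_mem_of_mem`) and all integers `b`, `N ≥ 1`, `M ≥ 4` with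
`H(I; b) = dim ℚ[x]_b − dim I_b ≥ M`, some form `R ∉ I` of degree `b` with integer coefficients
of modulus `≤ N` (`1 ≤ |R| ≤ N`, `h(R) ≤ log N`) has
`|R(1, ω)| ≤ exp(c (b + 1) − ((M − 4)/2) log(N + 1))` (Dirichlet's box principle on the
`#B = H(I; b) ≥ M` standard monomials of degree `b` modulo `I`, with `k = (N+1)^{⌊(#B−1)/2⌋}`).
[folklore] -/
theorem boxPrinciple_modIdeal : ∀ (m : ℕ) (ω : Fin m → ℂ),
    ∃ c : ℝ, 0 < c ∧ ∀ (I : Ideal (Rx m)) (b N M : ℕ),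
      (∀ f ∈ I, ∀ d : ℕ, homogeneousComponent d f ∈ I) → 1 ≤ N → 4 ≤ M →
      finrank ℚ ↥(homogeneousSubmodule (Fin (m + 1)) ℚ b ⊓ I.restrictScalars ℚ) + M ≤
        finrank ℚ ↥(homogeneousSubmodule (Fin (m + 1)) ℚ b) →
      ∃ R : Rx m, R ∉ I ∧ R.IsHomogeneous b ∧ 1 ≤ maxNorm R ∧ maxNorm R ≤ N ∧
        height R ≤ Real.log N ∧
        ‖aeval (Fin.cons 1 ω : Fin (m + 1) → ℂ) R‖ ≤
          Real.exp (c * (b + 1) - ((M : ℝ) - 4) / 2 * Real.log ((N : ℝ) + 1)) := by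
  intro m ω
  have hA₀ : 1 ≤ max 1 ‖ω‖ := le_max_left _ _
  have hlogA₀ : 0 ≤ Real.log (max 1 ‖ω‖) := Real.log_nonneg hA₀
  refine ⟨3 + m + Real.log (max 1 ‖ω‖), by positivity, ?_⟩
  intro I b N M hI hN hM hHilb
  classical
  obtain ⟨B, hBdeg, hBcard, hBle, hBind⟩ := BoxModIdeal.exists_standard_monomials hI b
  have hMB : M ≤ B.card := by omega
  -- the point `ω̄ = (1, ω)` and the values of the monomials at it
  set ω' : Fin (m + 1) → ℂ := Fin.cons 1 ω with hω'def
  have hω' : ∀ i, ‖ω' i‖ ≤ max 1 ‖ω‖ := by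
    refine Fin.cases ?_ ?_
    · simp [hω'def]
    · intro i
      rw [hω'def, Fin.cons_succ]
      exact (norm_le_pi_norm ω i).trans (le_max_right _ _)
  have hval : ∀ e : Fin (m + 1) →₀ ℕ, e.degree = b →
      ‖e.prod fun i k => ω' i ^ k‖ ≤ (max 1 ‖ω‖) ^ b := by
    intro e he
    rw [Finsupp.prod, norm_prod]
    calc ∏ i ∈ e.support, ‖ω' i ^ e i‖ ≤ ∏ i ∈ e.support, (max 1 ‖ω‖) ^ e i := by
          refine Finset.prod_le_prod (fun i _ => norm_nonneg _) fun i _ => ?_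
          rw [norm_pow]
          exact pow_le_pow_left₀ (norm_nonneg _) (hω' i) _
      _ = (max 1 ‖ω‖) ^ b := by rw [Finset.prod_pow_eq_pow_sum, ← Finsupp.degree_apply, he]
  -- the box principle
  obtain ⟨E, hE⟩ : ∃ E : ℕ, E = (B.card - 1) / 2 := ⟨_, rfl⟩
  obtain ⟨k, hk⟩ : ∃ k : ℕ, k = (N + 1) ^ E := ⟨_, rfl⟩
  have hk0 : 0 < k := by rw [hk]; positivity
  have hlt : k ^ (2 * Fintype.card (Fin 1)) < (N + 1) ^ Fintype.card ↥B := by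
    rw [Fintype.card_coe, Fintype.card_fin, mul_one, hk, ← pow_mul]
    exact Nat.pow_lt_pow_right (by omega) (by omega)
  obtain ⟨p, hp0, hpN, hpsmall⟩ :=
    Literature.NumberTheory.Transcendental.Waldschmidt1981.box_principle_complex
      (fun (_ : Fin 1) (j : ↥B) => (j : Fin (m + 1) →₀ ℕ).prod fun i k => ω' i ^ k)
      (A := (max 1 ‖ω‖) ^ b) (by positivity) (fun _ j => hval j (hBdeg j j.2)) N k hk0 hlt
  -- the form `R = ∑ p_β x^β`
  obtain ⟨Z, hZ⟩ : ∃ Z : MvPolynomial (Fin (m + 1)) ℤ,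
      Z = ∑ j : ↥B, monomial (j : Fin (m + 1) →₀ ℕ) (p j) := ⟨_, rfl⟩
  obtain ⟨R, hRZ⟩ : ∃ R : Rx m, R = MvPolynomial.map (Int.castRingHom ℚ) Z := ⟨_, rfl⟩
  have hR : R = ∑ j : ↥B, monomial (j : Fin (m + 1) →₀ ℕ) ((p j : ℤ) : ℚ) := by
    rw [hRZ, hZ, map_sum]
    simp only [map_monomial, eq_intCast]
  have hcoeff : ∀ e, R.coeff e = if h : e ∈ B then ((p ⟨e, h⟩ : ℤ) : ℚ) else 0 := by
    intro e
    rw [hR, coeff_sum]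
    simp only [coeff_monomial]
    split_ifs with h
    · rw [Finset.sum_eq_single (⟨e, h⟩ : ↥B)]
      · simp
      · intro j _ hj
        rw [if_neg]
        exact fun h' => hj (Subtype.ext h')
      · intro h'
        exact absurd (Finset.mem_univ _) h'
    · refine Finset.sum_eq_zero fun j _ => ?_
      rw [if_neg]
      rintro rfl
      exact h j.2
  have hsupp : R.support ⊆ B := by
    intro e he
    by_contra h
    rw [MvPolynomial.mem_support_iff, hcoeff e, dif_neg h] at he
    exact he rfl
  obtain ⟨j₀, hj₀⟩ := Function.ne_iff.mp hp0
  have hj₀' : p j₀ ≠ 0 := by simpa using hj₀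
  have hRj₀ : R.coeff j₀ = p j₀ := by rw [hcoeff, dif_pos j₀.2]
  have hR0 : R ≠ 0 := by
    intro h
    rw [h, coeff_zero] at hRj₀
    exact hj₀' (by exact_mod_cast hRj₀.symm)
  have hZ0 : Z ≠ 0 := fun h => hR0 (by rw [hRZ, h, map_zero])
  have hmax1 : 1 ≤ maxNorm R := by
    refine le_trans ?_ (norm_coeff_le_maxNorm R j₀)
    rw [hRj₀, Int.norm_cast_rat, Int.norm_eq_abs]
    exact_mod_cast Int.one_le_abs hj₀'
  have hmaxN : maxNorm R ≤ N := by
    refine CycleAPIOne.maxNorm_le_of_forall_le R (Nat.cast_nonneg N) fun e => ?_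
    rw [hcoeff]
    split_ifs with h
    · rw [Int.norm_cast_rat, Int.norm_eq_abs]
      have := hpN ⟨e, h⟩
      exact_mod_cast this
    · rw [norm_zero]
      exact Nat.cast_nonneg N
  refine ⟨R, fun hRI => hR0 (hBind R hsupp hRI), ?_, hmax1, hmaxN, ?_, ?_⟩
  · rw [hR]
    exact IsHomogeneous.sum _ _ _ fun j _ => isHomogeneous_monomial _ (hBdeg _ j.2)
  · have hh := height_map_le_log_maxNorm Z hZ0
    rw [← hRZ] at hh
    exact hh.trans (Real.log_le_log (by linarith) hmaxN)
  · have hval_eq : aeval ω' R =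
        ∑ j : ↥B, (p j : ℂ) * (j : Fin (m + 1) →₀ ℕ).prod fun i k => ω' i ^ k := by
      rw [hR, map_sum]
      refine Finset.sum_congr rfl fun j _ => ?_
      rw [aeval_monomial, eq_ratCast, Rat.cast_intCast]
    rw [hval_eq]
    have h := hpsmall 0
    simp only [Fintype.card_coe] at h
    exact BoxModIdeal.final_bound hA₀ hN hM hMB hBle hE hk h

/-- **Dirichlet's box principle for forms in `m + 1` variables** (the case `I = 0`): for
`ω ∈ ℂᵐ`, with `c = 3 + m + log max(1, ‖ω‖)`, for all `b`, `N ≥ 1` and `4 ≤ M ≤ binom(b + m, b)`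
some NON-ZERO form `P` of degree `b` with integer coefficients of modulus `≤ N` (`1 ≤ |P| ≤ N`,
`h(P) ≤ log N`) has `|P(1, ω)| ≤ exp(c (b + 1) − ((M − 4)/2) log(N + 1))`. [folklore] -/
theorem boxPrinciple : ∀ (m : ℕ) (ω : Fin m → ℂ),
    ∃ c : ℝ, 0 < c ∧ ∀ (b N M : ℕ), 1 ≤ N → 4 ≤ M → M ≤ (b + m).choose b →
      ∃ P : Rx m, P ≠ 0 ∧ P.IsHomogeneous b ∧ 1 ≤ maxNorm P ∧ maxNorm P ≤ N ∧
        height P ≤ Real.log N ∧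
        ‖aeval (Fin.cons 1 ω : Fin (m + 1) → ℂ) P‖ ≤
          Real.exp (c * (b + 1) - ((M : ℝ) - 4) / 2 * Real.log ((N : ℝ) + 1)) := by
  intro m ω
  obtain ⟨c, hc, h⟩ := boxPrinciple_modIdeal m ω
  refine ⟨c, hc, fun b N M hN hM hMle => ?_⟩
  have hbot : ∀ f ∈ (⊥ : Ideal (Rx m)), ∀ d : ℕ,
      homogeneousComponent d f ∈ (⊥ : Ideal (Rx m)) := fun f hf d => by
    rw [Ideal.mem_bot] at hf ⊢
    rw [hf, map_zero]
  have hfin : finrank ℚ ↥(homogeneousSubmodule (Fin (m + 1)) ℚ b ⊓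
      (⊥ : Ideal (Rx m)).restrictScalars ℚ) + M ≤
        finrank ℚ ↥(homogeneousSubmodule (Fin (m + 1)) ℚ b) := by
    rw [Submodule.restrictScalars_bot, inf_bot_eq, finrank_bot, zero_add,
      Literature.RingTheory.HilbertSamuel.finrank_homogeneousSubmodule_fin,
      show b + (m + 1) - 1 = b + m by omega]
    exact hMle
  obtain ⟨P, hPI, hPhom, h1, h2, h3, h4⟩ := h ⊥ b N M hbot hN hM hfin
  exact ⟨P, fun hP0 => hPI (hP0 ▸ Submodule.zero_mem _), hPhom, h1, h2, h3, h4⟩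

end Summit.Schanuel.Schanuel.Cruxes.ApproximationProperty.OrbitInterpolationDeterminant

end
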